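import Mathlib
import Literature.Analysis.FluidPDE.SelfSimilarEulerOutgoingExclusionTools
import HarnessLib

/-!
# VORTICITY IS TRANSPORTED ALONG BACKWARD SIMILARITY ORBITS — stub D3 `stub_vorticityTransport` of line `outflow_dive` (ns-idea-11 g7) for the
# crux `EulerZoomLiouville.PowerGaugeEulerLiouville` (stmt-NavierStokesRegularity-19832, THE ONE STATEMENT `stub_selfSimilarC2Needle`; width seat ns-ezl-w1 g5)

Route №10 `EulerZoomLiouville` (NavierStokesRegularity).  Class-free: let `(V, P′)` be a `C²` self-similar Euler profile on `ℝ³` (`γ = 1/(2+ρ)`,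
centre `0`), `W = γy + V`, `Ω = curl V`, and `Y : [0, σ₁] → ℝ³` an arc with `Y′ = −W(Y)`.  The curl of the profile equation is the vorticity
transport law `Ω + DΩ[W] = DV·Ω` (CIV (3.4); tree: `IsSelfSimilarEulerProfile.isSelfSimilarEulerVorticityProfile`,
`IsSelfSimilarEulerVorticityProfile.vorticity_eq_transport`), so `Z = Ω∘Y` solves the LINEAR ODE `Z′ = Z − DV(Y)·Z` with a coefficient bounded on
`[0, σ₁]`; Grönwall on the reversed arc `s ↦ Z(σ₁ − s)` (`norm_le_gronwallBound_of_norm_deriv_right_le`, `gronwallBound 0 K 0 = 0`) gives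
`Z(σ₁) = 0 ⇒ Z(0) = 0`, i.e.

  `curl V (Y 0) ≠ 0 → curl V (Y σ₁) ≠ 0`     (`vorticityTransport`, the text of `Sig.stub_vorticityTransport` verbatim).

HONEST LABEL: class-free calculus stub of a files-only line; nothing here excludes a needle.  WHAT THIS IS NOT: not NS, not E — `--supports` stmt-19832
on the MODEL lattice; 19832 OPEN; NS regularity NOT proved. [folklore; ConstantinIgnatovaVicol2026Putative §3.1.1 (3.4), §3.4.1 (3.21)]
-/

noncomputable section

-- flat `Theorems/<Route><Decl>…` files of one crux share the namespace of the crux (tree convention)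
set_option linter.dupNamespace false

open MeasureTheory Set Filter Topology Metric Function InnerProductSpace
open scoped RealInnerProductSpace NNReal ENNReal

namespace Summit.NavierStokesRegularity.NavierStokesRegularity.Theorems.PowerGaugeEulerLiouville.OutflowDive

open Literature.Analysis Literature.Analysis.FluidPDE

/-- **VORTICITY IS TRANSPORTED ALONG ORBITS** (the text of `Sig.stub_vorticityTransport` of line `outflow_dive`, verbatim): along a backward arc
`Y′ = −W(Y)` on `[0, σ₁]` of a `C²` self-similar Euler profile, `curl V (Y 0) ≠ 0 → curl V (Y σ₁) ≠ 0` (linear ODE `(Ω∘Y)′ = Ω∘Y − DV(Y)·(Ω∘Y)`,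
Grönwall backward from `σ₁`). [folklore; ConstantinIgnatovaVicol2026Putative §3.1.1 (3.4)] -/
theorem vorticityTransport :
    ∀ ρ : ℝ, 0 < ρ → ρ ≤ 1 / 2 →
    ∀ (V : EuclideanSpace ℝ (Fin 3) → EuclideanSpace ℝ (Fin 3)) (P' : EuclideanSpace ℝ (Fin 3) → ℝ),
      IsSelfSimilarEulerProfile (1 / (2 + ρ)) 0 V P' →
      ∀ σ₁ : ℝ, 0 ≤ σ₁ → ∀ Y : ℝ → EuclideanSpace ℝ (Fin 3),
        (∀ σ ∈ Set.Icc 0 σ₁, HasDerivAt Y (-(selfSimilarTransport (1 / (2 + ρ)) 0 V (Y σ))) σ) →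
        curl V (Y 0) ≠ 0 → curl V (Y σ₁) ≠ 0 := by
  intro ρ hρ hρh V P' hprof σ₁ hσ₁ Y hY hΩ0 hΩ1
  apply hΩ0
  set γ : ℝ := 1 / (2 + ρ) with hγdef
  set W : EuclideanSpace ℝ (Fin 3) → EuclideanSpace ℝ (Fin 3) := selfSimilarTransport γ 0 V with hWdef
  set Ω : EuclideanSpace ℝ (Fin 3) → EuclideanSpace ℝ (Fin 3) := curl V with hΩdef
  have hV2 : ContDiff ℝ 2 V := hprof.contDiff_velocity
  have hΩd : Differentiable ℝ Ω := differentiable_curl_of_contDiff hV2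
  have hvort := hprof.isSelfSimilarEulerVorticityProfile
  -- the transport law: `DΩ(y)[W y] = DV(y)(Ω y) − Ω y`
  have htr : ∀ y, fderiv ℝ Ω y (W y) = fderiv ℝ V y (Ω y) - Ω y := fun y => by
    have e := hvort.vorticity_eq_transport y
    rw [← e]; simp [hΩdef, hWdef]
  -- continuity of `Y` on the arc and a bound for `‖DV(Y σ)‖`
  have hYc : ContinuousOn Y (Icc 0 σ₁) := fun σ hσ => (hY σ hσ).continuousAt.continuousWithinAt
  have hDVc : Continuous fun y => fderiv ℝ V y := hV2.continuous_fderiv (by norm_num)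
  obtain ⟨K, hK⟩ := (isCompact_Icc (a := (0 : ℝ)) (b := σ₁)).exists_bound_of_continuousOn
    ((hDVc.comp_continuousOn hYc).norm)
  have hK0 : 0 ≤ K := (norm_nonneg _).trans (hK 0 (left_mem_Icc.2 hσ₁))
  -- the reversed arc `g s = Ω (Y (σ₁ − s))`
  set g : ℝ → EuclideanSpace ℝ (Fin 3) := fun s => Ω (Y (σ₁ - s)) with hgdef
  set g' : ℝ → EuclideanSpace ℝ (Fin 3) := fun s =>
    fderiv ℝ V (Y (σ₁ - s)) (Ω (Y (σ₁ - s))) - Ω (Y (σ₁ - s)) with hg'def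
  have hmem : ∀ s ∈ Icc (0 : ℝ) σ₁, σ₁ - s ∈ Icc (0 : ℝ) σ₁ := fun s hs =>
    ⟨by linarith [hs.2], by linarith [hs.1]⟩
  have hgd : ∀ s ∈ Icc (0 : ℝ) σ₁, HasDerivAt g (g' s) s := by
    intro s hs
    have hYs := hY (σ₁ - s) (hmem s hs)
    -- `Z = Ω∘Y` at `σ₁ − s`
    have hZ : HasDerivAt (fun σ => Ω (Y σ)) (fderiv ℝ Ω (Y (σ₁ - s)) (-(W (Y (σ₁ - s))))) (σ₁ - s) :=
      (hΩd (Y (σ₁ - s))).hasFDerivAt.comp_hasDerivAt (σ₁ - s) hYs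
    have hrev : HasDerivAt (fun s : ℝ => σ₁ - s) (-1 : ℝ) s := by
      simpa using (hasDerivAt_id s).const_sub σ₁
    have hcomp := hZ.scomp s hrev
    refine hcomp.congr_deriv ?_
    rw [map_neg, htr]
    simp only [hg'def, smul_neg, neg_smul, one_smul, smul_sub]
    abel
  have hgc : ContinuousOn g (Icc 0 σ₁) := fun s hs => (hgd s hs).continuousAt.continuousWithinAt
  have hbound : ∀ s ∈ Ico (0 : ℝ) σ₁, ‖g' s‖ ≤ (K + 1) * ‖g s‖ + 0 := by
    intro s hs
    have hs' : s ∈ Icc (0 : ℝ) σ₁ := Ico_subset_Icc_self hs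
    have hKs := hK (σ₁ - s) (hmem s hs')
    simp only [Function.comp, norm_norm] at hKs
    rw [add_zero, hg'def]
    calc ‖fderiv ℝ V (Y (σ₁ - s)) (Ω (Y (σ₁ - s))) - Ω (Y (σ₁ - s))‖
        ≤ ‖fderiv ℝ V (Y (σ₁ - s)) (Ω (Y (σ₁ - s)))‖ + ‖Ω (Y (σ₁ - s))‖ := norm_sub_le _ _
      _ ≤ ‖fderiv ℝ V (Y (σ₁ - s))‖ * ‖Ω (Y (σ₁ - s))‖ + ‖Ω (Y (σ₁ - s))‖ := by
          gcongr; exact ContinuousLinearMap.le_opNorm _ _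
      _ ≤ K * ‖Ω (Y (σ₁ - s))‖ + ‖Ω (Y (σ₁ - s))‖ := by gcongr
      _ = (K + 1) * ‖g s‖ := by rw [hgdef]; ring
  have h0 : ‖g 0‖ ≤ 0 := by
    rw [hgdef]
    simp only [sub_zero]
    rw [show Ω (Y σ₁) = 0 from hΩ1, norm_zero]
  have hgron := norm_le_gronwallBound_of_norm_deriv_right_le hgc (fun s hs => (hgd s (Ico_subset_Icc_self hs)).hasDerivWithinAt)
    h0 hbound σ₁ (right_mem_Icc.2 hσ₁)
  rw [gronwallBound_ε0_δ0] at hgron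
  have : g σ₁ = 0 := norm_le_zero_iff.1 hgron
  simpa [hgdef] using this

end Summit.NavierStokesRegularity.NavierStokesRegularity.Theorems.PowerGaugeEulerLiouville.OutflowDive

end
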